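import Mathlib
import Summits.ValiantsHypothesis.ValiantsHypothesis.Theorems.BarrierLeverPartitionMinorsHitByVPHiddenStatesFit
import Summits.ValiantsHypothesis.ValiantsHypothesis.Theorems.BarrierLeverPartitionMinorsHitByVPHiddenStatesAffineSplit
import Summits.ValiantsHypothesis.ValiantsHypothesis.Theorems.BarrierLeverPartitionMinorsHitByVPHiddenStatesFreeParts

/-!
# Route BarrierLever — item `PartitionMinorsHitByVP` (stmt-ValiantsHypothesis-19717), line `hidden-states`:
# THE COMBINATORIAL FITTING CERTIFICATE `AFit` (affinely-closed nodes, affinely-free leaves) and its typed conjecture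

Helper file (`--supports stmt-ValiantsHypothesis-19717`; cell valiant-natproofs, rung V4, 𝒟-side door (c), registered line
`Cruxes/PartitionMinorsHitByVP/Lines/hidden_states.lean` v4, stub `stub_fit` / `stub_universalJoinWide`; prover seat val-np-p6 gen 8).
Declares the inductive certificate predicate `AFit` and the Prop `Stmt.afitConjecture` (a CONJECTURE, typed, not asserted). Closes NO item.

THE POINT (memo val-np-p6 g8 «cut-tree certifiability»). val-np-p3 g10's `Fit` (p588547) is a tree of split steps carrying NUMERIC cut
constants `(β, γ)` with leaves «every column alone in its piece». `AFit` is the same tree in purely COMBINATORIAL dress: a node carries a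
coordinate, the four enumerations and the AFFINE-CLOSURE condition on the deletion-class columns (`symGood_of_affSplit`, p591757 — the
constants are supplied by `exists_cut_of_affClosed`, p591478); a leaf is any configuration whose pieces are AFFINELY FREE
(`symGood_of_affFree`, p589275) — stars, sub-stars, cornered families — or a `Fit` certificate (`ofFit`, so `AFit ⊇ Fit`). Soundness
`AFit.symDet_ne_zero` / `AFit.exists_table`; the typed conjecture `Stmt.afitConjecture` (some legal wide join design is `AFit`-certified
against every injective `u`) implies the node verbatim (`universalJoinWide_of_afitConjecture`) and follows from `Stmt.fitConjecture`
(`afitConjecture_of_fitConjecture`). This is exactly the certificate format produced by the census solver kit/cuttree (HOME/val-np-p6/g8).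

WHAT THIS IS NOT: `Stmt.afitConjecture` is OPEN; nothing is asserted about it; item 19717 OPEN; nothing on crux 14610 or VP ≠ VNP.
-/

set_option linter.dupNamespace false

namespace Summit.ValiantsHypothesis.ValiantsHypothesis.Theorems.BarrierLever.HiddenStates

open Finset Matrix MvPolynomial

noncomputable section

namespace SymbJoin

variable {h m K : ℕ}

/-- **The combinatorial fitting certificate.** `AFit u e` holds if (leaf) every piece of `e` is affinely free and `u` is injective, or
(embedded leaf) `Fit u e`, or (node) there are a coordinate `x` and enumerations of the deletion rows / link rows / deletion-class columns /
link-class columns such that the deletion class is affinely closed inside every piece and both sub-configurations are `AFit`. -/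
inductive AFit : {r : ℕ} → (Fin r → Finset (Fin h)) → (Fin r → Fin m × Finset (Fin K)) → Prop
  | free {r : ℕ} (u : Fin r → Finset (Fin h)) (e : Fin r → Fin m × Finset (Fin K)) (hu : Function.Injective u)
      (hfree : ∀ p, LinearIndependent ℂ fun k : {k : Fin r // (e k).1 = p} =>
        (fun o : Option (Fin K) => Option.elim o (1 : ℂ) fun q => if q ∈ (e k.1).2 then 1 else 0)) : AFit u e
  | ofFit {r : ℕ} (u : Fin r → Finset (Fin h)) (e : Fin r → Fin m × Finset (Fin K)) (hF : Fit u e) : AFit u e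
  | split {r r₀ r₁ : ℕ} (u : Fin r → Finset (Fin h)) (e : Fin r → Fin m × Finset (Fin K)) (x : Fin h) (hr : r₀ + r₁ = r)
      (f₀ : Fin r₀ → Fin r) (f₁ : Fin r₁ → Fin r) (g₀ : Fin r₀ → Fin r) (g₁ : Fin r₁ → Fin r)
      (hf : Function.Injective (Sum.elim f₀ f₁)) (hg : Function.Injective (Sum.elim g₀ g₁))
      (hrow0 : ∀ j, x ∉ u (f₀ j)) (hrow1 : ∀ j, x ∈ u (f₁ j))
      (haff : ∀ k, k ∉ Finset.univ.image g₀ →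
        (fun o : Option (Fin K) => Option.elim o (1 : ℂ) fun q => if q ∈ (e k).2 then 1 else 0) ∉
          Submodule.span ℂ ((fun k' => fun o : Option (Fin K) => Option.elim o (1 : ℂ) fun q => if q ∈ (e k').2 then 1 else 0) ''
            {k' | k' ∈ Finset.univ.image g₀ ∧ (e k').1 = (e k).1}))
      (h0 : AFit (fun j : Fin r₀ => u (f₀ j)) (fun j => e (g₀ j)))
      (h1 : AFit (fun j : Fin r₁ => (u (f₁ j)).erase x) (fun j => e (g₁ j))) : AFit u e

/-- **A combinatorial fitting certificate proves generic goodness.** -/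
theorem AFit.symDet_ne_zero {r : ℕ} {u : Fin r → Finset (Fin h)} {e : Fin r → Fin m × Finset (Fin K)} (hF : AFit u e) :
    symDet u e ≠ 0 := by
  induction hF with
  | free u e hu hfree => exact symGood_of_affFree u hu e hfree
  | ofFit u e hF => exact hF.symDet_ne_zero
  | split u e x hr f₀ f₁ g₀ g₁ hf hg hrow0 hrow1 haff _ _ ih0 ih1 =>
    exact symGood_of_affSplit u e x hr f₀ f₁ g₀ g₁ hf hg hrow0 hrow1 haff ih0 ih1

/-- **… hence the numeric `∃ tx, det ≠ 0` of the line's stubs.** -/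
theorem AFit.exists_table {r : ℕ} {u : Fin r → Finset (Fin h)} {e : Fin r → Fin m × Finset (Fin K)} (hF : AFit u e) :
    ∃ tx : Fin m → Option (Fin K) → Fin h → ℂ,
      (Matrix.of fun i k : Fin r =>
        ∏ a ∈ u i, (tx (e k).1 none a + ∑ q ∈ (e k).2, tx (e k).1 (some q) a)).det ≠ 0 :=
  exists_table_of_symGood u e hF.symDet_ne_zero

/-! ## The typed conjecture and its consequence for the node -/

/-- **CONJECTURE (combinatorial F⁺, typed; not asserted).** For all large `h` and every `r ≤ 2^h` there is ONE legal wide join threshold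
family (`m ≤ 2h` pieces, `K ≤ h³` states) that is `AFit`-certified against EVERY injective row family. -/
def Stmt.afitConjecture : Prop :=
  ∃ h₁ : ℕ, ∀ h : ℕ, h₁ ≤ h → ∀ r : ℕ, r ≤ 2 ^ h →
    ∃ (m K : ℕ) (W : Fin m → ℕ) (wt : Fin m → Fin K → ℕ) (e : Fin r → Fin m × Finset (Fin K)),
      m ≤ h + h ∧ K ≤ h * h * h ∧ Function.Injective e ∧
      (∀ x : Fin m × Finset (Fin K), x ∉ Set.range e →
        ∀ i, W (e i).1 + ∑ k ∈ (e i).2, wt (e i).1 k < W x.1 + ∑ k ∈ x.2, wt x.1 k) ∧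
      ∀ u : Fin r → Finset (Fin h), Function.Injective u → AFit u e

/-- **The conjecture node from the combinatorial fitting conjecture.** -/
theorem universalJoinWide_of_afitConjecture (hC : Stmt.afitConjecture) : Stmt.universalJoinWide := by
  obtain ⟨h₁, H⟩ := hC
  refine ⟨h₁, fun h hh r hr => ?_⟩
  obtain ⟨m, K, W, wt, e, hm, hK, he, hthr, hfit⟩ := H h hh r hr
  exact ⟨m, K, W, wt, e, hm, hK, he, hthr, fun u hu => (hfit u hu).exists_table⟩

/-- `AFit ⊇ Fit`, so p3's `Stmt.fitConjecture` implies `Stmt.afitConjecture`. -/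
theorem afitConjecture_of_fitConjecture (hC : Stmt.fitConjecture) : Stmt.afitConjecture := by
  obtain ⟨h₁, H⟩ := hC
  refine ⟨h₁, fun h hh r hr => ?_⟩
  obtain ⟨m, K, W, wt, e, hm, hK, he, hthr, hfit⟩ := H h hh r hr
  exact ⟨m, K, W, wt, e, hm, hK, he, hthr, fun u hu => AFit.ofFit u e (hfit u hu)⟩

end SymbJoin

end

end Summit.ValiantsHypothesis.ValiantsHypothesis.Theorems.BarrierLever.HiddenStates
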